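import Mathlib
import Summits.Ventures.PercRepro2.LocRows
import Summits.Ventures.PercRepro2.SwRow
import Summits.Ventures.PercRepro2.SwOut
import Summits.Ventures.PercRepro2.SwAllRow
import Summits.Ventures.PercRepro2.SwOutAll
import Summits.Ventures.PercRepro2.SwOutArmFlip
import Summits.Ventures.PercRepro2.SwOutArmThm
import Summits.Ventures.PercRepro2.SwOutCoreDefs
import Summits.Ventures.PercRepro2.SwOutCoreHull
import Summits.Ventures.PercRepro2.SwOutCoreDual
import Summits.Ventures.PercRepro2.SwOutShadowDefs
import Summits.Ventures.PercRepro2.SwOutShadowCube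
import Summits.Ventures.PercRepro2.SwOutCoreShadowDefs
import Summits.Ventures.PercRepro2.SwOutCoreShadowFlip

/-!
# Toggles: flips of arm selections along the core cube and the shadow cube (blind cell
PercRepro2, night-4 g14, 2026-08-26; proofs/NIGHT4-G14.md §1)

Flipping a selection of arms of a core base moves a cube point to the cube point with those
coordinates toggled (`CoreBase.flip_armsSel_coreReal`); the same along a shadow cube
(`ShadowBase.flip_shadowSel_shadowReal`).  The MIRROR flip `flip (sX ∪ sZ)` of the shadow data
of a one-sided point is the flip of all the arms adjacent to `u` (`CoreBase.flip_sXZ_eq`), hence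
toggles exactly the u-adjacent coordinates (`CoreBase.flip_sXZ_coreReal`).  The bookkeeping
behind the key of the escaping points (NIGHT4-G14.md §3).
-/

namespace Summit.Ventures.PercRepro2

namespace LocRows

open Hull

variable {V : Type*} {E : Type*}

open scoped Classical

variable {ends : E → Sym2 V}

section Toggle

variable {ι : Type*}

/-- The toggle of a cube point on the coordinates selected by `p`. -/
noncomputable def toggle (p : ι → Prop) (ω : Config ι) : Config ι := fun i => if p i then !ω i else ω i

/-- The toggle on a selected coordinate. -/
lemma toggle_apply_of_pos {p : ι → Prop} {ω : Config ι} {i : ι} (hi : p i) :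
    toggle p ω i = !ω i := by
  simp [toggle, hi]

/-- The toggle on an unselected coordinate. -/
lemma toggle_apply_of_neg {p : ι → Prop} {ω : Config ι} {i : ι} (hi : ¬ p i) :
    toggle p ω i = ω i := by
  simp [toggle, hi]

/-- Toggling twice is the identity. -/
lemma toggle_toggle (p : ι → Prop) (ω : Config ι) : toggle p (toggle p ω) = ω := by
  funext i
  by_cases hi : p i
  · rw [toggle_apply_of_pos hi, toggle_apply_of_pos hi, Bool.not_not]
  · rw [toggle_apply_of_neg hi, toggle_apply_of_neg hi]

/-- The toggle of everything is `flipAll`. -/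
lemma toggle_true (ω : Config ι) : toggle (fun _ => True) ω = flipAll ω := by
  funext i
  simp [toggle, flipAll]

/-- The selection of the arms satisfying `p`. -/
def armsSel (A : ι → Set V) (p : ι → Prop) : Set V := {x | ∃ i, p i ∧ x ∈ A i}

/-- Membership in a selection. -/
lemma mem_armsSel_iff {A : ι → Set V} {p : ι → Prop} {x : V} :
    x ∈ armsSel A p ↔ ∃ i, p i ∧ x ∈ A i := Iff.rfl

/-- A selection lies in the arms. -/
lemma armsSel_subset_allArms (A : ι → Set V) (p : ι → Prop) : armsSel A p ⊆ allArms A :=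
  fun _ ⟨i, _, hx⟩ => ⟨i, hx⟩

/-- `armsFalseC` is a selection. -/
lemma armsFalseC_eq_armsSel (A : ι → Set V) (ω : Config ι) :
    armsFalseC A ω = armsSel A (fun i => ω i = false) := rfl

end Toggle

/-- Two vertex sets touching the same edges give the same flip. -/
lemma flip_congr_touches {P Q : Set V} (h : touches ends P = touches ends Q) (ζ : Config E) :
    flip ends P ζ = flip ends Q ζ := by
  funext e
  simp only [Hull.flip, h]

section Core

variable {ι : Type*} {A : ι → Set V} {pure : ι → Prop} {ζ : Config E} {h u : V} {H : Set V}
  (hb : CoreBase ends ζ h u H A pure)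
include hb

/-- An edge with an end in `A i` touches the selection `armsSel A p` iff `p i`. -/
lemma CoreBase.mem_touches_armsSel_iff {p : ι → Prop} {i : ι} {e : E} {x y : V}
    (hxy : ends e = s(x, y)) (hx : x ∈ A i) : e ∈ touches ends (armsSel A p) ↔ p i :=
  hb.mem_touches_sel_iff hxy hx

/-- **Flipping a selection of arms toggles those coordinates.** -/
theorem CoreBase.flip_armsSel_coreReal (p : ι → Prop) (ω : Config ι) :
    flip ends (armsSel A p) (coreReal ends A ζ ω) = coreReal ends A ζ (toggle p ω) := by
  funext e
  by_cases he : e ∈ touches ends (allArms A)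
  · obtain ⟨i, x, y, hxy, hx⟩ := CoreBase.exists_arm_of_touches_allArms he
    rw [hb.coreReal_apply_of_mem (ω := toggle p ω) hxy hx]
    by_cases hp : p i
    · rw [flip_apply_of_mem ((hb.mem_touches_armsSel_iff hxy hx).2 hp),
        hb.coreReal_apply_of_mem (ω := ω) hxy hx, toggle_apply_of_pos hp]
      cases ω i <;> simp
    · rw [flip_apply_of_notMem (fun h' => hp ((hb.mem_touches_armsSel_iff hxy hx).1 h')),
        hb.coreReal_apply_of_mem (ω := ω) hxy hx, toggle_apply_of_neg hp]
  · rw [flip_apply_of_notMem (fun h' => he (touches_mono (armsSel_subset_allArms A p) h')),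
      CoreBase.coreReal_apply_of_notMem he, CoreBase.coreReal_apply_of_notMem he]

omit hb in
/-- A cube point is the flip, in the base, of the arms it assigns `false`. -/
lemma CoreBase.coreReal_eq_flip_base (ω : Config ι) :
    coreReal ends A ζ ω = flip ends (armsSel A fun i => ω i = false) ζ := rfl

omit hb in
/-- The base is the cube point `⊤`. -/
lemma CoreBase.coreReal_top : coreReal ends A ζ (fun _ => true) = ζ := by
  unfold coreReal
  funext e
  apply flip_apply_of_notMem
  rintro ⟨x, ⟨i, hi, _⟩, _, _⟩
  simp at hi

/-- An edge touching `sX ∪ sZ` touches the arms adjacent to `u`, and conversely. -/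
lemma CoreBase.touches_sXZ_eq (ω₀ : Config ι) :
    touches ends (sX ends u A ω₀ ∪ sZ ends u A ω₀) = touches ends (armsSel A (uAdjC ends u A)) := by
  ext e
  constructor
  · rintro ⟨x, hx, y, hxy⟩
    rcases hx with hx | hx
    · rcases mem_sX_iff.1 hx with rfl | ⟨i, hi, _, hxi⟩
      · obtain ⟨j, hyj⟩ := hb.u_edges e y hxy
        exact ⟨y, ⟨j, ⟨e, y, hxy, hyj⟩, hyj⟩, x, ends_swap hxy⟩
      · exact ⟨x, ⟨i, hi, hxi⟩, y, hxy⟩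
    · obtain ⟨i, hi, _, hxi⟩ := hx
      exact ⟨x, ⟨i, hi, hxi⟩, y, hxy⟩
  · rintro ⟨x, ⟨i, hi, hxi⟩, y, hxy⟩
    cases hω : ω₀ i with
    | true => exact ⟨x, Or.inl (mem_sX_iff.2 (Or.inr ⟨i, hi, hω, hxi⟩)), y, hxy⟩
    | false => exact ⟨x, Or.inr ⟨i, hi, hω, hxi⟩, y, hxy⟩

/-- **The mirror flip is the flip of the arms adjacent to `u`.** -/
theorem CoreBase.flip_sXZ_eq (ω₀ : Config ι) (ρ : Config E) :
    flip ends (sX ends u A ω₀ ∪ sZ ends u A ω₀) ρ = flip ends (armsSel A (uAdjC ends u A)) ρ :=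
  flip_congr_touches (hb.touches_sXZ_eq ω₀) ρ

/-- **The mirror flip toggles the u-adjacent coordinates of a cube point.** -/
theorem CoreBase.flip_sXZ_coreReal (ω₀ ω : Config ι) :
    flip ends (sX ends u A ω₀ ∪ sZ ends u A ω₀) (coreReal ends A ζ ω) =
      coreReal ends A ζ (toggle (uAdjC ends u A) ω) := by
  rw [hb.flip_sXZ_eq, hb.flip_armsSel_coreReal]

omit hb in
/-- The far coordinates of a shadow point, as a selection of arms of the core base. -/
lemma CoreBase.farFalse_eq_armsSel (ω' : Config (Option {i : ι // ¬ uAdjC ends u A i})) :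
    farFalse (A := A) ω' = armsSel A (fun i => ∃ hi : ¬ uAdjC ends u A i, ω' (some ⟨i, hi⟩) = false) := by
  ext x
  simp only [farFalse, armsSel, Set.mem_setOf_eq]
  constructor
  · rintro ⟨i, hi, hx⟩
    exact ⟨i.1, ⟨i.2, hi⟩, hx⟩
  · rintro ⟨i, ⟨hi, hω⟩, hx⟩
    exact ⟨⟨i, hi⟩, hω, hx⟩

end Core

section Shadow

variable {κ : Type*} {B : κ → Set V} {Z : Set V} {k₀ : κ} {σ : Config E} {h : V}
  (hb : ShadowBase ends σ h Z B k₀)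
include hb

/-- Flips of two selections compose to the flip of the symmetric difference selection. -/
theorem ShadowBase.flip_shadowSel_flip_shadowSel (p q : κ → Prop) :
    flip ends (shadowSel B Z k₀ p) (flip ends (shadowSel B Z k₀ q) σ) =
      flip ends (shadowSel B Z k₀ fun j => Xor (p j) (q j)) σ := by
  funext e
  by_cases he : e ∈ touches ends (shadowAll B Z)
  · have key : ∀ (r : κ → Prop) (j : κ), (e ∈ touches ends (shadowSel B Z k₀ r) ↔ r j) →
        True := fun _ _ _ => trivial
    rcases ShadowBase.exists_coord he with ⟨j, x, y, hxy, hx⟩ | ⟨x, y, hxy, hx, hyB⟩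
    · have hp := hb.touches_shadowSel_iff_of_mem (p := p) hxy hx
      have hq := hb.touches_shadowSel_iff_of_mem (p := q) hxy hx
      have hpq := hb.touches_shadowSel_iff_of_mem (p := fun j => Xor (p j) (q j)) hxy hx
      by_cases hpj : p j <;> by_cases hqj : q j
      · rw [flip_apply_of_mem (hp.2 hpj), flip_apply_of_mem (hq.2 hqj), flip_apply_of_notMem
          (fun h' => by
            rcases hpq.1 h' with ⟨_, h2⟩ | ⟨_, h2⟩
            · exact h2 hqj
            · exact h2 hpj), Bool.not_not]
      · rw [flip_apply_of_mem (hp.2 hpj), flip_apply_of_notMem (fun h' => hqj (hq.1 h')),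
          flip_apply_of_mem (hpq.2 (show Xor _ _ from Or.inl ⟨hpj, hqj⟩))]
      · rw [flip_apply_of_notMem (fun h' => hpj (hp.1 h')), flip_apply_of_mem (hq.2 hqj),
          flip_apply_of_mem (hpq.2 (show Xor _ _ from Or.inr ⟨hqj, hpj⟩))]
      · rw [flip_apply_of_notMem (fun h' => hpj (hp.1 h')),
          flip_apply_of_notMem (fun h' => hqj (hq.1 h')),
          flip_apply_of_notMem (fun h' => by
            rcases hpq.1 h' with ⟨h1, _⟩ | ⟨h1, _⟩
            · exact hpj h1
            · exact hqj h1)]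
    · have hp := hb.touches_shadowSel_iff_of_mem_Z (p := p) hxy hx hyB
      have hq := hb.touches_shadowSel_iff_of_mem_Z (p := q) hxy hx hyB
      have hpq := hb.touches_shadowSel_iff_of_mem_Z (p := fun j => Xor (p j) (q j)) hxy hx hyB
      by_cases hpj : p k₀ <;> by_cases hqj : q k₀
      · rw [flip_apply_of_mem (hp.2 hpj), flip_apply_of_mem (hq.2 hqj), flip_apply_of_notMem
          (fun h' => by
            rcases hpq.1 h' with ⟨_, h2⟩ | ⟨_, h2⟩
            · exact h2 hqj
            · exact h2 hpj), Bool.not_not]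
      · rw [flip_apply_of_mem (hp.2 hpj), flip_apply_of_notMem (fun h' => hqj (hq.1 h')),
          flip_apply_of_mem (hpq.2 (show Xor _ _ from Or.inl ⟨hpj, hqj⟩))]
      · rw [flip_apply_of_notMem (fun h' => hpj (hp.1 h')), flip_apply_of_mem (hq.2 hqj),
          flip_apply_of_mem (hpq.2 (show Xor _ _ from Or.inr ⟨hqj, hpj⟩))]
      · rw [flip_apply_of_notMem (fun h' => hpj (hp.1 h')),
          flip_apply_of_notMem (fun h' => hqj (hq.1 h')),
          flip_apply_of_notMem (fun h' => by
            rcases hpq.1 h' with ⟨h1, _⟩ | ⟨h1, _⟩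
            · exact hpj h1
            · exact hqj h1)]
  · have hn : ∀ r : κ → Prop, e ∉ touches ends (shadowSel B Z k₀ r) :=
      fun r h' => he (touches_mono (shadowSel_subset_shadowAll r) h')
    rw [flip_apply_of_notMem (hn _), flip_apply_of_notMem (hn _), flip_apply_of_notMem (hn _)]

/-- **Flipping a selection of shadow arms toggles those coordinates.** -/
theorem ShadowBase.flip_shadowSel_shadowReal (p : κ → Prop) (ω : Config κ) :
    flip ends (shadowSel B Z k₀ p) (shadowReal ends B Z k₀ σ ω) =
      shadowReal ends B Z k₀ σ (toggle p ω) := by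
  unfold shadowReal
  rw [shadowFalse_eq_shadowSel, shadowFalse_eq_shadowSel, hb.flip_shadowSel_flip_shadowSel]
  have key : ∀ j, Xor (p j) (ω j = false) ↔ toggle p ω j = false := by
    intro j
    by_cases hj : p j
    · rw [toggle_apply_of_pos hj]
      cases ω j <;> simp [Xor, hj]
    · rw [toggle_apply_of_neg hj]
      cases ω j <;> simp [Xor, hj]
  rw [show (fun j => Xor (p j) (ω j = false)) = (fun j => toggle p ω j = false) from
    funext fun j => propext (key j)]

end Shadow

end LocRows

end Summit.Ventures.PercRepro2
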